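import Summits.NavierStokesRegularity.NavierStokesRegularity.Theorems.HardyPointSinkHardyEnergyBoundNecessity
import Literature.Analysis.FluidPDE.KatoMaximalTimeSingular
import HarnessLib

/-!
# Route HardyPointSink — `HardyEnergyBound` (C2): reduction to the maximal time and to backward
singular points

Helper file for the crux item stmt-NavierStokesRegularity-7979 (line `birth`, lead c3). The line is
closed modulo its heart `stub_influxAbsorption` (≡ crux, `hardyEnergyBound_iff_influxAbsorption`).
Lead c2 proved LOCALISATION (`hardyEnergyBound_local_of_eLpNorm_parabolicCylinder_lt_top`: essential
boundedness on ONE backward cylinder `Q_r(T, xs)` gives the C2 bound at `xs`). This file turns the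
planners' prose "C2 has content only at `T = T_max`, at backward singular points" into tree theorems:

* `hardyEnergyBound_local_of_not_isBackwardSingularPoint` — if `(T, xs)` is NOT a backward singular
  point of the Kato solution `u` on `[0, T)` (`¬ IsBackwardSingularPoint u (T, xs)`, i.e. `u` is
  essentially bounded on some `Q_r(T, xs)`), the C2 bound holds at `xs` (shrink `r` below `√(T/2)`
  and localise);
* `hardyEnergyBound_local_of_katoMaximalTime_ne` — if `T` is not the maximal time of the datum
  (`katoMaximalTime ν u₀ ≠ T`; for a Kato solution on `[0, T)` this means `T < T_max(u₀)`), the C2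
  bound holds at EVERY `xs`: a backward singular point at `(T, xs)` would force `T_max(u₀) = T`
  (`katoMaximalTime_eq_of_isBackwardSingularPoint`, Rusin–Šverák 2011 §3);
* `hardyEnergyBound_local_of_hasGlobalKatoSolution` — in particular C2 holds for every datum with a
  global Kato solution;
* `hardyEnergyBound_iff_at_backwardSingularPoints` — **REDUCTION**: `HardyEnergyBound` is
  EQUIVALENT to its restriction to Kato solutions living exactly up to the maximal time
  (`katoMaximalTime ν u₀ = T`, finite) and to centres `xs` with `(T, xs)` a backward singular point.

So any future line for this crux may assume, at no cost, a Clay datum WITHOUT global Kato solution,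
its maximal Kato solution `u` on `[0, T_max)`, and a backward singular point `(T_max, xs)`.
-/

noncomputable section

open MeasureTheory Set Filter Topology Metric Function
open scoped ENNReal NNReal

set_option linter.dupNamespace false -- nested layout Summit.<S>.<Sub>, Sub = S (D-0017)

namespace Summit.NavierStokesRegularity.NavierStokesRegularity.Theorems

open Literature.Analysis.FluidPDE

/-! ### Off the backward singular set the bound is automatic -/

/-- **C2 at a non-singular point.** For `ν > 0`, `T > 0`, a Kato solution `u` on `[0, T)` and a
centre `xs` such that `(T, xs)` is not a backward singular point of `u` (so `u` is essentially
bounded on some backward cylinder `Q_r(T, xs)`), the conclusion of C2 holds at `xs`. Proof: pick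
such an `r`, shrink it to `r' = min r √(T/2)` (cylinders are monotone in the radius, so the
`L^∞` norm only decreases, and now `r'² < T`), and apply the localisation lemma
`hardyEnergyBound_local_of_eLpNorm_parabolicCylinder_lt_top`. -/
theorem hardyEnergyBound_local_of_not_isBackwardSingularPoint {ν : ℝ} (hν : 0 < ν)
    {u₀ : EuclideanSpace ℝ (Fin 3) → EuclideanSpace ℝ (Fin 3)} {T : ℝ} (hT : 0 < T)
    {u : ℝ → EuclideanSpace ℝ (Fin 3) → EuclideanSpace ℝ (Fin 3)} (hu : IsKatoSolutionOn T ν u₀ u)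
    {xs : EuclideanSpace ℝ (Fin 3)} (hns : ¬ IsBackwardSingularPoint u (T, xs)) :
    ∃ r₀ : ℝ, 0 < r₀ ∧ ∃ K : NNReal, ∀ x₀ ∈ Metric.ball xs r₀, ∀ t ∈ Set.Ico 0 T, T - r₀ ^ 2 < t →
      ∫⁻ x in Metric.ball xs r₀, ‖u t x‖ₑ ^ 2 / ‖x - x₀‖ₑ ≤ K := by
  -- a cylinder on which `u` is essentially bounded
  simp only [IsBackwardSingularPoint, not_forall] at hns
  obtain ⟨r, hr, hfin⟩ := hns
  have hfin' : eLpNorm (uncurry u) ∞ (volume.restrict (parabolicCylinder r ((T : ℝ), xs))) < ⊤ :=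
    lt_top_iff_ne_top.2 hfin
  -- shrink the radius below `√(T/2)`
  set s : ℝ := Real.sqrt (T / 2) with hs_def
  have hs : 0 < s := Real.sqrt_pos.2 (by linarith)
  have hs2 : s ^ 2 = T / 2 := Real.sq_sqrt (by linarith)
  set r' : ℝ := min r s with hr'_def
  have hr' : 0 < r' := lt_min hr hs
  have hr'r : r' ≤ r := min_le_left r s
  have hr's : r' ≤ s := min_le_right r s
  have hr'T : r' ^ 2 < T := by
    have h1 : r' ^ 2 ≤ s ^ 2 := pow_le_pow_left₀ hr'.le hr's 2
    linarith
  have hsub : parabolicCylinder r' ((T : ℝ), xs) ⊆ parabolicCylinder r ((T : ℝ), xs) := by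
    have h2 : r' ^ 2 ≤ r ^ 2 := pow_le_pow_left₀ hr'.le hr'r 2
    exact prod_mono (Ioo_subset_Ioo (by linarith) le_rfl) (ball_subset_ball hr'r)
  have hfin'' : eLpNorm (uncurry u) ∞ (volume.restrict (parabolicCylinder r' ((T : ℝ), xs))) < ⊤ :=
    lt_of_le_of_lt (eLpNorm_mono_measure (uncurry u) (Measure.restrict_mono hsub le_rfl)) hfin'
  exact hardyEnergyBound_local_of_eLpNorm_parabolicCylinder_lt_top hν hT hu hr' hr'T hfin''

/-! ### Below the maximal time the bound is automatic -/

/-- **C2 below the maximal time.** For `ν > 0`, `T > 0` and a Kato solution `u` on `[0, T)` from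
`u₀`: if `T` is not the maximal time of the datum (`katoMaximalTime ν u₀ ≠ T`; since a Kato
solution on `[0, T)` witnesses `T ≤ T_max(u₀)`, this says `T < T_max(u₀)`), then the conclusion of
C2 holds at every centre `xs`. Indeed a backward singular point `(T, xs)` of `u` would force
`T_max(u₀) = T` (`katoMaximalTime_eq_of_isBackwardSingularPoint`, from `mild_L3_smooth_holds` and
`kato_unique_holds`: a longer Kato solution is bounded near `(T, xs)` and agrees with `u` a.e.), so
`(T, xs)` is not singular and `hardyEnergyBound_local_of_not_isBackwardSingularPoint` applies. -/
theorem hardyEnergyBound_local_of_katoMaximalTime_ne {ν : ℝ} (hν : 0 < ν)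
    {u₀ : EuclideanSpace ℝ (Fin 3) → EuclideanSpace ℝ (Fin 3)} {T : ℝ} (hT : 0 < T)
    {u : ℝ → EuclideanSpace ℝ (Fin 3) → EuclideanSpace ℝ (Fin 3)} (hu : IsKatoSolutionOn T ν u₀ u)
    (hne : katoMaximalTime ν u₀ ≠ ENNReal.ofReal T) (xs : EuclideanSpace ℝ (Fin 3)) :
    ∃ r₀ : ℝ, 0 < r₀ ∧ ∃ K : NNReal, ∀ x₀ ∈ Metric.ball xs r₀, ∀ t ∈ Set.Ico 0 T, T - r₀ ^ 2 < t →
      ∫⁻ x in Metric.ball xs r₀, ‖u t x‖ₑ ^ 2 / ‖x - x₀‖ₑ ≤ K :=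
  hardyEnergyBound_local_of_not_isBackwardSingularPoint hν hT hu fun hsing =>
    hne (katoMaximalTime_eq_of_isBackwardSingularPoint mild_L3_smooth_holds hν hT hu hsing)

/-- **C2 for data with a global Kato solution.** If `u₀` has a global Kato solution at viscosity
`ν > 0` then `T_max(u₀) = ∞ ≠ T`, so the conclusion of C2 holds for every Kato solution on every
`[0, T)` from `u₀`, at every centre (`hardyEnergyBound_local_of_katoMaximalTime_ne`). -/
theorem hardyEnergyBound_local_of_hasGlobalKatoSolution {ν : ℝ} (hν : 0 < ν)
    {u₀ : EuclideanSpace ℝ (Fin 3) → EuclideanSpace ℝ (Fin 3)} (hg : HasGlobalKatoSolution ν u₀)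
    {T : ℝ} (hT : 0 < T) {u : ℝ → EuclideanSpace ℝ (Fin 3) → EuclideanSpace ℝ (Fin 3)}
    (hu : IsKatoSolutionOn T ν u₀ u) (xs : EuclideanSpace ℝ (Fin 3)) :
    ∃ r₀ : ℝ, 0 < r₀ ∧ ∃ K : NNReal, ∀ x₀ ∈ Metric.ball xs r₀, ∀ t ∈ Set.Ico 0 T, T - r₀ ^ 2 < t →
      ∫⁻ x in Metric.ball xs r₀, ‖u t x‖ₑ ^ 2 / ‖x - x₀‖ₑ ≤ K := by
  refine hardyEnergyBound_local_of_katoMaximalTime_ne hν hT hu ?_ xs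
  rw [hg.katoMaximalTime_eq_top]
  exact ENNReal.top_ne_ofReal

/-! ### The reduction -/

/-- **REDUCTION — `HardyEnergyBound` is equivalent to its restriction to the maximal time and to
backward singular points.** The crux C2 holds iff: for every `ν > 0`, Clay datum `u₀`, `T > 0` and
Kato solution `u` on `[0, T)` from `u₀` such that `T` IS the maximal time of the datum
(`katoMaximalTime ν u₀ = T`, in particular `u₀` has no global Kato solution and `u` is the maximal
solution) and every centre `xs` such that `(T, xs)` IS a backward singular point of `u`, the local
Hardy energy `∫_{B(xs,r₀)} |u(t,x)|²/|x − x₀| dx` is bounded uniformly in `x₀ ∈ B(xs, r₀)` and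
`T − r₀² < t < T` for some `r₀ > 0`. (`→` is specialisation; `←`: at a non-singular `(T, xs)` the
bound is `hardyEnergyBound_local_of_not_isBackwardSingularPoint`, and at a singular one
`T_max(u₀) = T` by `katoMaximalTime_eq_of_isBackwardSingularPoint`, so the hypothesis applies.)
This is the formal content of "C2 is trivial for `T < T_max` and says: every blow-up of a Kato
solution from Clay data is Hardy-bounded near each of its singular points". -/
theorem hardyEnergyBound_iff_at_backwardSingularPoints :
    Summit.NavierStokesRegularity.NavierStokesRegularity.Theses.HardyPointSink.HardyEnergyBound ↔ ∀ ν : ℝ, 0 < ν → ∀ u₀ : EuclideanSpace ℝ (Fin 3) → EuclideanSpace ℝ (Fin 3), ContDiff ℝ (⊤ : ℕ∞) u₀ → Literature.Analysis.FluidPDE.NSWave0.IsDivFree u₀ → Literature.Analysis.FluidPDE.HasRapidSpatialDecay u₀ → ∀ (T : ℝ) (u : ℝ → EuclideanSpace ℝ (Fin 3) → EuclideanSpace ℝ (Fin 3)), 0 < T → Literature.Analysis.FluidPDE.IsKatoSolutionOn T ν u₀ u → Literature.Analysis.FluidPDE.katoMaximalTime ν u₀ = ENNReal.ofReal T → ∀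 xs : EuclideanSpace ℝ (Fin 3), Literature.Analysis.FluidPDE.IsBackwardSingularPoint u (T, xs) → ∃ r₀ : ℝ, 0 < r₀ ∧ ∃ K : NNReal, ∀ x₀ ∈ Metric.ball xs r₀, ∀ t ∈ Set.Ico 0 T, T - r₀ ^ 2 < t → ∫⁻ x in Metric.ball xs r₀, ‖u t x‖ₑ ^ 2 / ‖x - x₀‖ₑ ≤ K := by
  constructor
  · intro h ν hν u₀ hsm hdiv hdec T u hT hu _ xs _
    exact h ν hν u₀ hsm hdiv hdec T u hT hu xs
  · intro h ν hν u₀ hsm hdiv hdec T u hT hu xs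
    by_cases hsing : IsBackwardSingularPoint u (T, xs)
    · exact h ν hν u₀ hsm hdiv hdec T u hT hu
        (katoMaximalTime_eq_of_isBackwardSingularPoint mild_L3_smooth_holds hν hT hu hsing) xs hsing
    · exact hardyEnergyBound_local_of_not_isBackwardSingularPoint hν hT hu hsing

/-- **Corollary — C2 off the blow-up data.** `HardyEnergyBound` restricted to data WITH a global
Kato solution is a theorem (`hardyEnergyBound_local_of_hasGlobalKatoSolution`); hence C2 is
equivalent to its restriction to Clay data without global Kato solution (the only data the route's
deciding theorem `closes` feeds into `HardyTypeIExtraction`). -/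
theorem hardyEnergyBound_iff_of_not_hasGlobalKatoSolution :
    Summit.NavierStokesRegularity.NavierStokesRegularity.Theses.HardyPointSink.HardyEnergyBound ↔
      ∀ ν : ℝ, 0 < ν → ∀ u₀ : EuclideanSpace ℝ (Fin 3) → EuclideanSpace ℝ (Fin 3),
        ContDiff ℝ (⊤ : ℕ∞) u₀ → NSWave0.IsDivFree u₀ → HasRapidSpatialDecay u₀ →
        ¬ HasGlobalKatoSolution ν u₀ →
        ∀ (T : ℝ) (u : ℝ → EuclideanSpace ℝ (Fin 3) → EuclideanSpace ℝ (Fin 3)), 0 < T →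
        IsKatoSolutionOn T ν u₀ u →
        ∀ xs : EuclideanSpace ℝ (Fin 3),
          ∃ r₀ : ℝ, 0 < r₀ ∧ ∃ K : NNReal, ∀ x₀ ∈ Metric.ball xs r₀, ∀ t ∈ Set.Ico 0 T,
            T - r₀ ^ 2 < t → ∫⁻ x in Metric.ball xs r₀, ‖u t x‖ₑ ^ 2 / ‖x - x₀‖ₑ ≤ K := by
  constructor
  · intro h ν hν u₀ hsm hdiv hdec _ T u hT hu xs
    exact h ν hν u₀ hsm hdiv hdec T u hT hu xs
  · intro h ν hν u₀ hsm hdiv hdec T u hT hu xs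
    by_cases hg : HasGlobalKatoSolution ν u₀
    · exact hardyEnergyBound_local_of_hasGlobalKatoSolution hν hg hT hu xs
    · exact h ν hν u₀ hsm hdiv hdec hg T u hT hu xs

end Summit.NavierStokesRegularity.NavierStokesRegularity.Theorems

end
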